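import Summits.ValiantsHypothesis.ValiantsHypothesis.Theorems.BarrierLeverChowThinBlockPeel

/-!
# Route BarrierLever — thin-row Chow witnesses (item 20195), part 4: the separating-set reduction
# (single forms `1 + y_c` on the coordinates not needed to separate the columns)

Helper file (`--supports stmt-ValiantsHypothesis-20195`; cell valiant-natproofs, rung V4, 𝒟-side of
door (c); seat val-np-p7 gen 3).  Closes NO item.

For a product `f'` of affine forms avoiding the variables `y_c` (`c ∈ F`), the partition coefficients of
`(∏_{c ∈ F} (1 + y_c)) · f'` are those of `f'` with the columns intersected away from `F`:
`coeff_{E u w}((∏_{c∈F}(1+y_c)) · f') = coeff_{E u (w \ F)} f'` (`coeff_partitionExpo_prodOneAddY_mul`,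
from the block peel of part 1 with the one-variable block `{y_c}`, where `1 + y_c` has both coefficients
`1`).  Consequently (`chow_hit_of_separating`): if the columns `w j` stay distinct after removing `F`
(i.e. the complement of `F` SEPARATES the column family) and the reduced layout `(u, w \ F)` is hit by a
product of `m` affine forms avoiding `y_F` with `m + |F| ≤ h + h`, then `(u, w)` is hit by a product of
`h + h` affine forms — the matrix of items 20172 / 20195 verbatim.  This is the first step of the uniform
design of the seat's memos (minimal separating set `K = [h] \ F`; it costs one form per discarded
coordinate instead of two), valid for rows of any size.

WHAT THIS IS NOT: bookkeeping; nothing on items 20195 / 20172 / 19717 themselves, on crux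
stmt-ValiantsHypothesis-14610, or on `VP ≠ VNP`.
-/

set_option linter.dupNamespace false

namespace Summit.ValiantsHypothesis.ValiantsHypothesis.Theorems.BarrierLever.ChowThinAffine

open Finset MvPolynomial
open Summit.ValiantsHypothesis.ValiantsHypothesis.Theorems.BarrierLever.ProductStateSums
  (castAdd_ne_natAdd partitionExpo_apply_castAdd partitionExpo_apply_natAdd)

variable {h : ℕ}

/-- The single form `1 + y_c` uses only the variable `y_c`. -/
theorem vars_one_add_y (c : Fin h) :
    (C 1 + X (Fin.natAdd h c) : MvPolynomial (Fin (h + h)) ℂ).vars ⊆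
      (∅ : Finset (Fin h)).image (Fin.castAdd h) ∪ ({c} : Finset (Fin h)).image (Fin.natAdd h) := by
  classical
  intro v hv
  have h1 := vars_add_subset (C 1 : MvPolynomial (Fin (h + h)) ℂ) (X (Fin.natAdd h c)) hv
  rw [vars_C, Finset.empty_union, vars_X, Finset.mem_singleton] at h1
  rw [Finset.mem_union, Finset.mem_image, Finset.mem_image]
  exact Or.inr ⟨c, Finset.mem_singleton_self c, h1.symm⟩

/-- Both partition coefficients of the single form `1 + y_c` (at `1` and at `y_c`) are `1`. -/
theorem coeff_one_add_y (c : Fin h) (W : Finset (Fin h)) (hW : W ⊆ {c}) :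
    coeff (∑ a' ∈ (∅ : Finset (Fin h)), Finsupp.single (Fin.castAdd h a') 1 +
        ∑ c' ∈ W, Finsupp.single (Fin.natAdd h c') 1)
      (C 1 + X (Fin.natAdd h c) : MvPolynomial (Fin (h + h)) ℂ) = 1 := by
  classical
  rw [Finset.sum_empty, zero_add, coeff_add, coeff_C, coeff_X]
  rcases Finset.subset_singleton_iff.mp hW with hW0 | hW1
  · rw [hW0, Finset.sum_empty, if_pos rfl, if_neg]
    · ring
    · exact Finsupp.single_ne_zero.mpr one_ne_zero
  · rw [hW1, Finset.sum_singleton, if_neg, if_pos rfl]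
    · ring
    · exact (Finsupp.single_ne_zero.mpr one_ne_zero).symm

/-- **Peeling one single form.**  If `f` avoids `y_c`, then
`coeff_{E u w}((1 + y_c) · f) = coeff_{E u (w.erase c)} f`. -/
theorem coeff_partitionExpo_oneAddY_mul (f : MvPolynomial (Fin (h + h)) ℂ) (c : Fin h)
    (hf : Fin.natAdd h c ∉ f.vars) (u w : Finset (Fin h)) :
    coeff (∑ a' ∈ u, Finsupp.single (Fin.castAdd h a') 1 + ∑ c' ∈ w, Finsupp.single (Fin.natAdd h c') 1)
        ((C 1 + X (Fin.natAdd h c)) * f) =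
      coeff (∑ a' ∈ u, Finsupp.single (Fin.castAdd h a') 1 +
        ∑ c' ∈ w.erase c, Finsupp.single (Fin.natAdd h c') 1) f := by
  classical
  have hq : Disjoint f.vars
      ((∅ : Finset (Fin h)).image (Fin.castAdd h) ∪ ({c} : Finset (Fin h)).image (Fin.natAdd h)) := by
    rw [Finset.image_empty, Finset.empty_union, Finset.image_singleton, Finset.disjoint_singleton_right]
    exact hf
  rw [coeff_partitionExpo_mul_block _ f ∅ {c} (vars_one_add_y c) hq u w]
  have hu1 : u.filter (fun a' => a' ∈ (∅ : Finset (Fin h))) = ∅ := by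
    ext a; simp
  have hu2 : u.filter (fun a' => a' ∉ (∅ : Finset (Fin h))) = u := by
    ext a; simp
  have hw2 : w.filter (fun c' => c' ∉ ({c} : Finset (Fin h))) = w.erase c := by
    ext d; simp [Finset.mem_erase, and_comm]
  have hw1 : w.filter (fun c' => c' ∈ ({c} : Finset (Fin h))) ⊆ {c} := by
    intro d hd; rw [Finset.mem_filter] at hd; exact hd.2
  rw [hu1, hu2, hw2, coeff_one_add_y c _ hw1, one_mul]

/-- **Peeling all single forms.**  If `f` avoids `y_c` for every `c ∈ F`, then
`coeff_{E u w}((∏_{c∈F} (1 + y_c)) · f) = coeff_{E u (w \ F)} f`. -/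
theorem coeff_partitionExpo_prodOneAddY_mul (F : Finset (Fin h)) :
    ∀ (f : MvPolynomial (Fin (h + h)) ℂ), (∀ c ∈ F, Fin.natAdd h c ∉ f.vars) →
      ∀ u w : Finset (Fin h),
        coeff (∑ a' ∈ u, Finsupp.single (Fin.castAdd h a') 1 +
            ∑ c' ∈ w, Finsupp.single (Fin.natAdd h c') 1)
            ((∏ c ∈ F, (C 1 + X (Fin.natAdd h c) : MvPolynomial (Fin (h + h)) ℂ)) * f) =
          coeff (∑ a' ∈ u, Finsupp.single (Fin.castAdd h a') 1 +
            ∑ c' ∈ w \ F, Finsupp.single (Fin.natAdd h c') 1) f := by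
  classical
  induction F using Finset.induction_on with
  | empty =>
    intro f _ u w
    rw [Finset.prod_empty, one_mul, Finset.sdiff_empty]
  | insert c F hcF ih =>
    intro f hf u w
    rw [Finset.prod_insert hcF, mul_assoc]
    have hvars : Fin.natAdd h c ∉ ((∏ c' ∈ F, (C 1 + X (Fin.natAdd h c') :
        MvPolynomial (Fin (h + h)) ℂ)) * f).vars := by
      intro hv
      rcases Finset.mem_union.mp (vars_mul _ _ hv) with h1 | h2
      · have h3 := vars_prod _ h1
        rw [Finset.mem_biUnion] at h3
        obtain ⟨c', hc'F, hvc'⟩ := h3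
        have h4 := vars_one_add_y c' hvc'
        rw [Finset.image_empty, Finset.empty_union, Finset.image_singleton,
          Finset.mem_singleton] at h4
        exact hcF ((Fin.natAdd_injective _ _ h4) ▸ hc'F)
      · exact hf c (Finset.mem_insert_self c F) h2
    rw [coeff_partitionExpo_oneAddY_mul _ c hvars u w,
      ih f (fun c' hc' => hf c' (Finset.mem_insert_of_mem hc')) u (w.erase c)]
    congr 3
    ext d
    simp only [Finset.mem_sdiff, Finset.mem_erase, Finset.mem_insert, not_or]
    tauto

/-- **Separating-set reduction for Chow witnesses.**  Let `F ⊆ [h]` be a set of `y`-coordinates and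
`ℓ'` a family of `m` affine forms avoiding `y_c` for `c ∈ F`, with `m + |F| ≤ h + h`.  If the reduced
layout `(u, w \ F)` is hit by `∏ ℓ'` (nonzero partition minor), then the layout `(u, w)` is hit by a
product of `h + h` affine forms: `ℓ'`, the single forms `1 + y_c` (`c ∈ F`), and ones.  (Typically
`[h] \ F` is a minimal separating set of the columns, so that `j ↦ w j \ F` is still injective.) -/
theorem chow_hit_of_separating {r m : ℕ} (u w : Fin r → Finset (Fin h)) (F : Finset (Fin h))
    (ℓ' : Fin m → MvPolynomial (Fin (h + h)) ℂ) (hdeg : ∀ k, (ℓ' k).totalDegree ≤ 1)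
    (hvars : ∀ k, ∀ c ∈ F, Fin.natAdd h c ∉ (ℓ' k).vars) (hm : m + F.card ≤ h + h)
    (hdet : (Matrix.of fun i j : Fin r => MvPolynomial.coeff
      (∑ a ∈ u i, Finsupp.single (Fin.castAdd h a) 1 +
        ∑ c ∈ w j \ F, Finsupp.single (Fin.natAdd h c) 1) (∏ k, ℓ' k)).det ≠ 0) :
    ∃ ℓ : Fin (h + h) → MvPolynomial (Fin (h + h)) ℂ, (∀ k, (ℓ k).totalDegree ≤ 1) ∧
      (Matrix.of fun i j : Fin r => MvPolynomial.coeff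
        (∑ a ∈ u i, Finsupp.single (Fin.castAdd h a) 1 + ∑ c ∈ w j, Finsupp.single (Fin.natAdd h c) 1)
        (∏ k, ℓ k)).det ≠ 0 := by
  classical
  -- index bookkeeping: `Fin (h + h) ≃ Fin (m + (F.card + rest))`
  set rest : ℕ := h + h - m - F.card with hrest
  have hcast : m + (F.card + rest) = h + h := by omega
  let e : Fin F.card ≃o F := F.orderIsoOfFin rfl
  let singles : Fin F.card → MvPolynomial (Fin (h + h)) ℂ :=
    fun i => C 1 + X (Fin.natAdd h ((e i : F) : Fin h))
  let ones : Fin rest → MvPolynomial (Fin (h + h)) ℂ := fun _ => 1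
  let ℓ₀ : Fin (m + (F.card + rest)) → MvPolynomial (Fin (h + h)) ℂ :=
    Fin.append ℓ' (Fin.append singles ones)
  have hdeg0 : ∀ k' : Fin (m + (F.card + rest)), (ℓ₀ k').totalDegree ≤ 1 := by
    intro k'
    induction k' using Fin.addCases with
    | left k₁ =>
      show (Fin.append ℓ' (Fin.append singles ones) (Fin.castAdd _ k₁)).totalDegree ≤ 1
      rw [Fin.append_left]; exact hdeg k₁
    | right k₂ =>
      show (Fin.append ℓ' (Fin.append singles ones) (Fin.natAdd _ k₂)).totalDegree ≤ 1
      rw [Fin.append_right]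
      induction k₂ using Fin.addCases with
      | left i =>
        rw [Fin.append_left]
        refine (totalDegree_add _ _).trans (max_le ?_ ?_)
        · rw [totalDegree_C]; exact Nat.zero_le _
        · exact (totalDegree_X _).le
      | right i' => rw [Fin.append_right, totalDegree_one]; exact Nat.zero_le _
  refine ⟨fun k => ℓ₀ (Fin.cast hcast.symm k), fun k => hdeg0 _, ?_⟩
  · -- the product of all forms is `(∏_{c ∈ F} (1 + y_c)) * (∏ ℓ')`
    have hprod : (∏ k : Fin (h + h), ℓ₀ (Fin.cast hcast.symm k)) =
        (∏ c ∈ F, (C 1 + X (Fin.natAdd h c) : MvPolynomial (Fin (h + h)) ℂ)) * ∏ k, ℓ' k := by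
      have h1 : (∏ k : Fin (h + h), ℓ₀ (Fin.cast hcast.symm k)) = ∏ k : Fin (m + (F.card + rest)), ℓ₀ k :=
        Fintype.prod_equiv (finCongr hcast.symm) _ _ (fun _ => rfl)
      rw [h1, Fin.prod_univ_add, Fin.prod_univ_add]
      simp only [ℓ₀, Fin.append_left, Fin.append_right, ones, Finset.prod_const_one, mul_one]
      rw [mul_comm]
      congr 1
      have h2 : (∏ i : Fin F.card, singles i) = ∏ x : F, (C 1 + X (Fin.natAdd h (x : Fin h)) :
          MvPolynomial (Fin (h + h)) ℂ) :=
        Fintype.prod_equiv e.toEquiv _ _ (fun _ => rfl)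
      rw [h2, Finset.prod_coe_sort F (fun c => (C 1 + X (Fin.natAdd h c) : MvPolynomial (Fin (h + h)) ℂ))]
    rw [hprod]
    have hv : ∀ c ∈ F, Fin.natAdd h c ∉ (∏ k, ℓ' k).vars := by
      intro c hc hvc
      have := vars_prod _ hvc
      rw [Finset.mem_biUnion] at this
      obtain ⟨k, _, hk⟩ := this
      exact hvars k c hc hk
    have hmat : (Matrix.of fun i j : Fin r => MvPolynomial.coeff
        (∑ a ∈ u i, Finsupp.single (Fin.castAdd h a) 1 + ∑ c ∈ w j, Finsupp.single (Fin.natAdd h c) 1)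
        ((∏ c ∈ F, (C 1 + X (Fin.natAdd h c) : MvPolynomial (Fin (h + h)) ℂ)) * ∏ k, ℓ' k)) =
        (Matrix.of fun i j : Fin r => MvPolynomial.coeff
          (∑ a ∈ u i, Finsupp.single (Fin.castAdd h a) 1 +
            ∑ c ∈ w j \ F, Finsupp.single (Fin.natAdd h c) 1) (∏ k, ℓ' k)) := by
      ext i j
      rw [Matrix.of_apply, Matrix.of_apply]
      exact coeff_partitionExpo_prodOneAddY_mul F _ hv (u i) (w j)
    rw [hmat]
    exact hdet

end Summit.ValiantsHypothesis.ValiantsHypothesis.Theorems.BarrierLever.ChowThinAffine
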